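import Summits.BirchSwinnertonDyer.Rank1Residual.X1.LayerAlgebra
import Summits.BirchSwinnertonDyer.Rank1Residual.X1.CharIdealRestrictScalars
import Literature.NumberTheory.EllipticCurves.IwasawaAlgebraPseudoNullProofs
import Literature.NumberTheory.EllipticCurves.IwasawaAlgebraRankOneIdealProofs
import Literature.NumberTheory.EllipticCurves.CharIdealDualInflationStepProofs
import Mathlib.RingTheory.Ideal.AssociatedPrime.Finiteness
import Mathlib.RingTheory.Ideal.UFD
import HarnessLib

/-!
# The characteristic ideal of an Iwasawa module RESTRICTED to `Λ(Γ^{pⁿ}) ⊂ Λ(Γ)` is the NORM of its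
# characteristic ideal (`char_{Λ_n}(X) = N_{Λ/Λ_n}(char_Λ X)`) — generic kernel form

Cell `bsd-print-cf2`, EXTRA WIDTH seat `bsd-line-cf2-p1-w3` g6, planner brick **B10** (RULING (af)(3)) for
crux `PrintCf2.SplitBadTwoRankOneOfFacts` (stmt-BirchSwinnertonDyer-20368): «char ideal over `Λ(Γ²)` of
the restricted module = NORM of the char ideal over `Λ(Γ)`», generic commutative-algebra form (any `p`,
any `n`). THEOREMS ONLY (no `def`, no named fact, no `sorry`); Theses-free; nothing about any curve;
`--supports` the crux as a helper. BSD is not proved by any of this; no summit statement is proved here.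

`Λ = ℤ_p⟦T⟧ ≅ ℤ_p⟦Γ⟧` (`γ ↦ 1 + T`); the Iwasawa algebra of `Γ^{pⁿ}` is `Λ_n = ℤ_p⟦ω_n⟧`,
`ω_n = (1+T)^{pⁿ} − 1 ↔ γ^{pⁿ}`, the image of the X1 cell's `layerHom p n : Λ →+* Λ`, `T ↦ ω_n`
(`Rank1Residual/X1/LayerAlgebra`: `Λ` is free of rank `pⁿ` over it — type synonym `Layer p n` —, norm
`layerNorm p n = N_{Λ/Λ_n} : Λ →* Λ` in the variable of `Λ_n ≅ ℤ_p⟦S⟧`). A `Λ`-module `X` RESTRICTED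
to `Γ^{pⁿ}`, written in the variable of `Λ_n ≅ Λ`, is any `Λ`-module `Y` with a `layerHom p n`-SEMILINEAR
bijection `ψ : Y → X` (`ψ (a • y) = a(ω_n) • ψ y`; e.g. the Pontryagin dual of ONE Selmer group over the
cyclotomic tower, read over `K` (generator `γ`) and over the layer `K_n` (generator `γ^{pⁿ}`)).
* `charIdeal_eq_span_layerNorm_of_semilinear`: **`X` finitely generated torsion, `char_Λ X = (f)` ⟹
  `char_Λ Y = (N_n f)`**, with `moduleFinite_of_semilinear`, `isTorsion_of_semilinear`,
  `exists_charIdeal_eq_span_layerNorm_of_semilinear`; `charIdeal_map_eq_span_of_semilinear` — the same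
  after `PowerSeries.map J` (`J : ℤ_p → 𝒪`, the currency `D.charIdeal.map (PowerSeries.map J) = span {·}`
  of the tree's main-conjecture statements) with `map_layerHom_eq_subst_map`
  (`(g(ω_n)).map J = (g.map J)((1+T)^{pⁿ} − 1)`).
The X1 cell has the case of a module WITHOUT non-zero finite submodules (square presentation,
`X1/GeneratorBoundOrdLayer`); here that hypothesis is removed. PROOF: dévissage along a prime filtration
(Mathlib `IsNoetherianRing.induction_on_isQuotientEquivQuotientPrime`), the motive quantifying over all
`(Y, ψ)`: (i) `X ≅ Λ/(π)`, `(π)` of height one (`Λ` is a UFD): `Y ≃ₗ[Λ] Layer p n ⧸ π·Layer p n`, the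
cokernel of multiplication by `π` on the free `Λ_n`-module `Λ`, of characteristic ideal `(det) = (N_n π)`
(X1 `CharIdealRestrictScalars.charIdeal_quotient_range_eq_span_det`); (ii) `X` finite (`Λ/𝔪`, or `0`):
both ideals are `1` (finite = pseudo-null over `Λ`); (iii) short exact sequences: `Y₁ = ψ⁻¹(X₁)`,
`Y/Y₁ ≅ X₃`, `char` multiplicative on both sides (`Module.charIdeal_eq_mul_of_exact`), `N_n` multiplicative.

References: L. C. Washington, *Introduction to Cyclotomic Fields*, GTM 83, §13.2 (restriction to
`ℤ_p⟦ω_n⟧`, Lemma 13.15 ff.) [Washington1997]; N. Bourbaki, *Algèbre commutative* VII §4 no. 5 and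
*Algèbre* III §9 (norm = determinant) [BourbakiAC5to7]; R. Greenberg, LNM 1716 (1999), §1 [GreenbergLNM1716].
-/

noncomputable section

set_option linter.dupNamespace false -- D-0017: single-problem summit, `…BirchSwinnertonDyer.BirchSwinnertonDyer…` repeats a namespace by design

open scoped Classical

namespace Summit.BirchSwinnertonDyer.BirchSwinnertonDyer.Theorems.PrintCf2.LayerNormCharIdeal

open Literature.NumberTheory.EllipticCurves IsLocalRing
  Summit.BirchSwinnertonDyer.Rank1Residual.X1 Summit.BirchSwinnertonDyer.Rank1Residual.X1.LayerAlgebra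

universe v w

variable {p : ℕ} [Fact p.Prime] {n : ℕ}

/-! ## §1. Generic helpers -/

/-- The characteristic ideal is invariant under linear equivalences. [folklore] -/
theorem charIdeal_eq_of_linearEquiv {R : Type*} [CommRing R] {M N : Type*} [AddCommGroup M]
    [Module R M] [AddCommGroup N] [Module R N] (e : M ≃ₗ[R] N) :
    Module.charIdeal R M = Module.charIdeal R N := by
  unfold Module.charIdeal
  exact finprod_mem_congr rfl fun 𝔭 _ => by rw [Module.lengthAt_eq_of_linearEquiv e 𝔭]

/-- Torsion is invariant under linear equivalences. [folklore] -/
theorem isTorsion_of_linearEquiv {R : Type*} [CommRing R] {M N : Type*} [AddCommGroup M]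
    [Module R M] [AddCommGroup N] [Module R N] (e : M ≃ₗ[R] N) (hM : Module.IsTorsion R M) :
    Module.IsTorsion R N := by
  intro y
  obtain ⟨a, ha⟩ := @hM (e.symm y)
  refine ⟨a, by simpa [Submonoid.smul_def] using congrArg e ha⟩

/-- Associated generators of `Λ` have associated layer norms, hence equal norm ideals. [folklore] -/
theorem span_layerNorm_eq_of_span_eq {f g : IwasawaAlgebra p}
    (h : Ideal.span ({f} : Set (IwasawaAlgebra p)) = Ideal.span {g}) :
    Ideal.span ({layerNorm p n f} : Set (IwasawaAlgebra p)) = Ideal.span {layerNorm p n g} :=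
  Ideal.span_singleton_eq_span_singleton.2
    (associated_layerNorm p n (Ideal.span_singleton_eq_span_singleton.1 h))

/-! ## §2. The finite case: both characteristic ideals are `1` -/

/-- **Finite case.** If `X` is finite and `ψ : Y → X` is an injective `layerHom`-semilinear map, then
`Y` is finite, hence finitely generated, torsion and with `char_Λ Y = 1`; and `char_Λ X = (f)` forces
`f` to be a unit, so `char_Λ Y = (N_n f)` as well. [cite: Washington1997, §13.2] -/
theorem finite_case {X : Type v} [AddCommGroup X] [Module (IwasawaAlgebra p) X] [Finite X]
    {Y : Type w} [AddCommGroup Y] [Module (IwasawaAlgebra p) Y]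
    (ψ : Y →ₛₗ[layerHom p n] X) (hψ : Function.Injective ψ) :
    Module.Finite (IwasawaAlgebra p) Y ∧ Module.IsTorsion (IwasawaAlgebra p) Y ∧
      ∀ f : IwasawaAlgebra p, Module.charIdeal (IwasawaAlgebra p) X = Ideal.span {f} →
        Module.charIdeal (IwasawaAlgebra p) Y = Ideal.span {layerNorm p n f} := by
  haveI : Finite Y := Finite.of_injective ψ hψ
  have hX : Module.charIdeal (IwasawaAlgebra p) X = ⊤ :=
    Module.charIdeal_eq_top_of_isPseudoNull (isPseudoNull_of_finite p X)
  refine ⟨Module.Finite.of_finite, Module.isTorsion_of_finite_iwasawa Y, fun f hf => ?_⟩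
  rw [hX, eq_comm, Ideal.span_singleton_eq_top] at hf
  rw [Module.charIdeal_eq_top_of_isPseudoNull (isPseudoNull_of_finite p Y), eq_comm,
    Ideal.span_singleton_eq_top]
  exact hf.map (layerNorm p n)

/-! ## §3. The cyclic case `X = Λ/(π)`: `Y ≅ Λ/(π)` restricted is the cokernel of `π` on `Layer p n` -/

/-- **Cyclic case.** For `π ≠ 0` and a `layerHom`-semilinear bijection `ψ : Y → Λ/(π)`, the
`Λ`-module `Y` is linearly isomorphic to `Layer p n ⧸ (π · Layer p n)`, the cokernel of multiplication
by `π` on the free rank-`pⁿ` module `Λ` over `Λ_n`; hence `Y` is finitely generated torsion with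
`char_Λ Y = (det) = (N_n π)`. [cite: Washington1997, §13.2] -/
theorem cyclic_case {π : IwasawaAlgebra p} (hπ : π ≠ 0)
    {Y : Type w} [AddCommGroup Y] [Module (IwasawaAlgebra p) Y]
    (ψ : Y →ₛₗ[layerHom p n] (IwasawaAlgebra p ⧸ Ideal.span ({π} : Set (IwasawaAlgebra p))))
    (hψ : Function.Bijective ψ) :
    Module.Finite (IwasawaAlgebra p) Y ∧ Module.IsTorsion (IwasawaAlgebra p) Y ∧
      Module.charIdeal (IwasawaAlgebra p) Y = Ideal.span {layerNorm p n π} := by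
  -- multiplication by `π` on the free `Λ`-module `Layer p n`
  let e' : Layer p n →ₗ[IwasawaAlgebra p] Layer p n :=
    LinearMap.mulLeft (IwasawaAlgebra p) (Layer.of p n π)
  have hdet : LinearMap.det e' = layerNorm p n π := by rw [layerNorm_apply, Algebra.norm_apply]; rfl
  have hdet0 : LinearMap.det e' ≠ 0 := hdet ▸ layerNorm_ne_zero p n hπ
  -- the inverse of `ψ`
  let φ : (IwasawaAlgebra p ⧸ Ideal.span ({π} : Set (IwasawaAlgebra p))) → Y :=
    (Equiv.ofBijective ψ hψ).symm
  have hψφ : ∀ z, ψ (φ z) = z := (Equiv.ofBijective ψ hψ).apply_symm_apply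
  have hφψ : ∀ y, φ (ψ y) = y := (Equiv.ofBijective ψ hψ).symm_apply_apply
  have hφadd : ∀ a b, φ (a + b) = φ a + φ b := fun a b =>
    hψ.1 (by rw [hψφ, map_add, hψφ, hψφ])
  have hφsmul : ∀ (a : IwasawaAlgebra p) (z), φ (layerHom p n a • z) = a • φ z := fun a z =>
    hψ.1 (by rw [hψφ, LinearMap.map_smulₛₗ, hψφ])
  have hφzero : ∀ z, φ z = 0 ↔ z = 0 := fun z =>
    ⟨fun h => by rw [← hψφ z, h, map_zero], fun h => by rw [h, ← map_zero ψ, hφψ]⟩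
  -- the quotient map `Λ → Λ/(π)` as scalar-compatible map
  have hq : ∀ (a g : IwasawaAlgebra p),
      (Ideal.Quotient.mk (Ideal.span ({π} : Set (IwasawaAlgebra p))) (a * g)) =
        a • Ideal.Quotient.mk (Ideal.span ({π} : Set (IwasawaAlgebra p))) g := fun a g => by
    rw [← smul_eq_mul]
    exact Submodule.Quotient.mk_smul (Ideal.span ({π} : Set (IwasawaAlgebra p))) a g
  -- `θ : Layer p n → Y`, `x ↦ ψ⁻¹ (x mod π)`
  let θ : Layer p n →ₗ[IwasawaAlgebra p] Y :=
    { toFun := fun x => φ (Ideal.Quotient.mk _ ((Layer.of p n).symm x))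
      map_add' := fun x y => by
        simp only [map_add, hφadd]
      map_smul' := fun a x => by
        have hx : (Layer.of p n).symm (a • x) = layerHom p n a * (Layer.of p n).symm x := by
          conv_lhs => rw [← (Layer.of p n).apply_symm_apply x, Layer.smul_of]
          rw [RingEquiv.symm_apply_apply]
        simp only [hx, hq, hφsmul, RingHom.id_apply] }
  have hθ_apply : ∀ x, θ x = φ (Ideal.Quotient.mk _ ((Layer.of p n).symm x)) := fun _ => rfl
  have hθsurj : Function.Surjective θ := by
    intro y
    obtain ⟨g, hg⟩ := Ideal.Quotient.mk_surjective (ψ y)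
    refine ⟨Layer.of p n g, ?_⟩
    rw [hθ_apply, RingEquiv.symm_apply_apply, hg, hφψ]
  have hker : LinearMap.ker θ = LinearMap.range e' := by
    ext x
    rw [LinearMap.mem_ker, hθ_apply, hφzero, Ideal.Quotient.eq_zero_iff_mem,
      Ideal.mem_span_singleton, LinearMap.mem_range]
    constructor
    · rintro ⟨c, hc⟩
      refine ⟨Layer.of p n c, ?_⟩
      change Layer.of p n π * Layer.of p n c = x
      rw [← map_mul, ← hc, RingEquiv.apply_symm_apply]
    · rintro ⟨y, rfl⟩
      refine ⟨(Layer.of p n).symm y, ?_⟩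
      change (Layer.of p n).symm (Layer.of p n π * y) = _
      rw [map_mul, RingEquiv.symm_apply_apply]
  -- `Y ≃ₗ[Λ] Layer p n ⧸ range e'`
  let E : (Layer p n ⧸ LinearMap.range e') ≃ₗ[IwasawaAlgebra p] Y :=
    (Submodule.quotEquivOfEq _ _ hker.symm).trans (LinearMap.quotKerEquivOfSurjective θ hθsurj)
  refine ⟨Module.Finite.equiv E, ?_, ?_⟩
  · exact isTorsion_of_linearEquiv E (CharIdealRestrictScalars.isTorsion_quotient_range e' hdet0)
  · rw [← charIdeal_eq_of_linearEquiv E,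
      CharIdealRestrictScalars.charIdeal_quotient_range_eq_span_det e' hdet0, hdet]

/-! ## §4. Dévissage: the restriction theorem for every finitely generated torsion `Λ`-module -/

/-- **The engine (prime-filtration induction).** For a finitely generated torsion `Λ`-module `X` and
ANY `layerHom p n`-semilinear bijection `ψ : Y → X` from a `Λ`-module `Y`: `Y` is finitely generated,
torsion, and `char_Λ X = (f) ⟹ char_Λ Y = (N_n f)`. The motive quantifies over all `(Y, ψ)`, so that
the short-exact-sequence step can restrict `ψ` to `ψ⁻¹(X₁)` and descend it to `Y/ψ⁻¹(X₁) → X₃`.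
[cite: Washington1997, §13.2] [cite: BourbakiAC5to7, Ch. VII §4 no. 5] -/
theorem finite_isTorsion_charIdeal_of_semilinear (X : Type v) [AddCommGroup X]
    [Module (IwasawaAlgebra p) X] [hfin : Module.Finite (IwasawaAlgebra p) X] :
    Module.IsTorsion (IwasawaAlgebra p) X →
      ∀ (Y : Type w) [AddCommGroup Y] [Module (IwasawaAlgebra p) Y]
        (ψ : Y →ₛₗ[layerHom p n] X), Function.Bijective ψ →
          Module.Finite (IwasawaAlgebra p) Y ∧ Module.IsTorsion (IwasawaAlgebra p) Y ∧
            ∀ f : IwasawaAlgebra p, Module.charIdeal (IwasawaAlgebra p) X = Ideal.span {f} →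
              Module.charIdeal (IwasawaAlgebra p) Y = Ideal.span {layerNorm p n f} := by
  induction hfin using IsNoetherianRing.induction_on_isQuotientEquivQuotientPrime (IwasawaAlgebra p) with
  | subsingleton N =>
    intro _ Y _ _ ψ hψ
    haveI : Finite N := Finite.of_subsingleton
    exact finite_case ψ hψ.1
  | quotient N 𝔮 e =>
    intro hN Y _ _ ψ hψ
    -- `𝔮 ≠ 0` since `N ≅ Λ/𝔮` is torsion
    have h𝔮0 : 𝔮.asIdeal ≠ ⊥ := by
      intro h0
      obtain ⟨a, ha⟩ := @hN (e.symm (Ideal.Quotient.mk 𝔮.asIdeal 1))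
      have h1 : (a : IwasawaAlgebra p) • (Ideal.Quotient.mk 𝔮.asIdeal (1 : IwasawaAlgebra p)) = 0 := by
        have h := congrArg e ha
        rwa [Submonoid.smul_def, map_smul, LinearEquiv.apply_symm_apply, map_zero] at h
      have h2 : Ideal.Quotient.mk 𝔮.asIdeal ((a : IwasawaAlgebra p) • (1 : IwasawaAlgebra p)) = 0 :=
        (Submodule.Quotient.mk_smul 𝔮.asIdeal (a : IwasawaAlgebra p) (1 : IwasawaAlgebra p)).trans h1
      rw [smul_eq_mul, mul_one, Ideal.Quotient.eq_zero_iff_mem, h0, Ideal.mem_bot] at h2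
      exact nonZeroDivisors.coe_ne_zero a h2
    by_cases hmax : 𝔮.asIdeal = maximalIdeal (IwasawaAlgebra p)
    · -- `Λ/𝔪` is finite
      haveI : Finite (IwasawaAlgebra p ⧸ 𝔮.asIdeal) := by
        rw [hmax]
        exact IwasawaAlgebra.finite_quotient_maximalIdeal p
      haveI : Finite N := Finite.of_equiv _ e.toEquiv.symm
      exact finite_case ψ hψ.1
    · -- `𝔮` has height one, hence is principal: `𝔮 = (π)`
      have hht : 𝔮.asIdeal.height = 1 :=
        le_antisymm (IwasawaAlgebra.height_le_one_of_ne_maximalIdeal p 𝔮.asIdeal hmax)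
          (Order.one_le_iff_ne_zero.2 fun h => h𝔮0 (Ideal.height_eq_zero_iff_eq_bot.mp h))
      haveI := UniqueFactorizationMonoid.isPrincipal_of_height_eq_one hht
      obtain ⟨π, hπ⟩ := Submodule.IsPrincipal.principal 𝔮.asIdeal
      have hπ' : 𝔮.asIdeal = Ideal.span {π} := hπ
      have hπ0 : π ≠ 0 := by
        rintro rfl
        exact h𝔮0 (by rw [hπ', Ideal.span_singleton_eq_bot])
      let e₁ : N ≃ₗ[IwasawaAlgebra p] (IwasawaAlgebra p ⧸ Ideal.span ({π} : Set (IwasawaAlgebra p))) :=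
        e.trans (Submodule.quotEquivOfEq _ _ hπ')
      let ψ' : Y →ₛₗ[layerHom p n] (IwasawaAlgebra p ⧸ Ideal.span ({π} : Set (IwasawaAlgebra p))) :=
        (e₁ : N →ₗ[IwasawaAlgebra p] _).comp ψ
      have hψ' : Function.Bijective ψ' := e₁.bijective.comp hψ
      obtain ⟨hF, hT, hC⟩ := cyclic_case hπ0 ψ' hψ'
      refine ⟨hF, hT, fun f hf => ?_⟩
      rw [hC]
      apply span_layerNorm_eq_of_span_eq
      rw [← hf, charIdeal_eq_of_linearEquiv e₁, Module.charIdeal_quotient_span_singleton hπ0]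
  | exact N₁ N₂ N₃ f g hf hg hfg ih₁ ih₃ =>
    intro hN₂ Y _ _ ψ hψ
    have hN₁ : Module.IsTorsion (IwasawaAlgebra p) N₁ := fun x => by
      obtain ⟨a, ha⟩ := @hN₂ (f x)
      exact ⟨a, hf (by simpa [Submonoid.smul_def] using ha)⟩
    have hN₃ : Module.IsTorsion (IwasawaAlgebra p) N₃ := fun z => by
      obtain ⟨y, rfl⟩ := hg z
      obtain ⟨a, ha⟩ := @hN₂ y
      exact ⟨a, by simpa [Submonoid.smul_def] using congrArg g ha⟩
    -- `Y₁ = ψ⁻¹(f(N₁))` and `ψ₁ : Y₁ → N₁`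
    let Y₁ : Submodule (IwasawaAlgebra p) Y := (LinearMap.range f).comap ψ
    let ef : N₁ ≃ₗ[IwasawaAlgebra p] LinearMap.range f := LinearEquiv.ofInjective f hf
    let ψ₁' : Y₁ →ₛₗ[layerHom p n] LinearMap.range f :=
      (ψ.domRestrict Y₁).codRestrict (LinearMap.range f) (fun y => y.2)
    let ψ₁ : Y₁ →ₛₗ[layerHom p n] N₁ := (ef.symm : LinearMap.range f →ₗ[IwasawaAlgebra p] N₁).comp ψ₁'
    have hψ₁ : Function.Bijective ψ₁ := by
      refine ef.symm.bijective.comp ⟨fun a b h => ?_, fun z => ?_⟩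
      · exact Subtype.ext (hψ.1 (congrArg Subtype.val h))
      · obtain ⟨x, hx⟩ := z.2
        obtain ⟨y, hy⟩ := hψ.2 (f x)
        have hy₁ : y ∈ Y₁ := by
          change ψ y ∈ LinearMap.range f
          rw [hy]
          exact ⟨x, rfl⟩
        exact ⟨⟨y, hy₁⟩, Subtype.ext (by rw [← hx]; exact hy)⟩
    -- `ψ₃ : Y/Y₁ → N₃`
    have hle : Y₁ ≤ LinearMap.ker ((g : N₂ →ₗ[IwasawaAlgebra p] N₃).comp ψ) := fun y hy => by
      obtain ⟨x, hx⟩ := hy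
      rw [LinearMap.mem_ker, LinearMap.comp_apply, ← hx]
      exact hfg.apply_apply_eq_zero x
    let ψ₃ : (Y ⧸ Y₁) →ₛₗ[layerHom p n] N₃ := Y₁.liftQ (g.comp ψ) hle
    have hψ₃ : Function.Bijective ψ₃ := by
      constructor
      · rw [← LinearMap.ker_eq_bot]
        refine Submodule.ker_liftQ_eq_bot _ _ _ (fun y hy => ?_)
        rw [LinearMap.mem_ker, LinearMap.comp_apply] at hy
        obtain ⟨x, hx⟩ := (hfg (ψ y)).mp hy
        exact ⟨x, hx⟩
      · intro z
        obtain ⟨y, rfl⟩ := hg z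
        obtain ⟨y', rfl⟩ := hψ.2 y
        exact ⟨Submodule.Quotient.mk y', rfl⟩
    obtain ⟨hF₁, hT₁, hC₁⟩ := ih₁ hN₁ Y₁ ψ₁ hψ₁
    obtain ⟨hF₃, hT₃, hC₃⟩ := ih₃ hN₃ (Y ⧸ Y₁) ψ₃ hψ₃
    -- `Y` is finitely generated and torsion (extension of such)
    have hFY : Module.Finite (IwasawaAlgebra p) Y := by
      rw [Module.finite_def]
      refine Submodule.fg_of_fg_map_of_fg_inf_ker Y₁.mkQ ?_ ?_
      · rw [Submodule.map_top, Submodule.range_mkQ]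
        exact hF₃.fg_top
      · rw [top_inf_eq, Submodule.ker_mkQ]
        exact Module.Finite.iff_fg.mp hF₁
    have hTY : Module.IsTorsion (IwasawaAlgebra p) Y := fun y => by
      obtain ⟨a, ha⟩ := @hT₃ (Submodule.Quotient.mk y)
      have hay : (a : IwasawaAlgebra p) • y ∈ Y₁ := by
        rw [← Submodule.Quotient.mk_eq_zero, Submodule.Quotient.mk_smul]
        exact ha
      obtain ⟨b, hb⟩ := @hT₁ ⟨(a : IwasawaAlgebra p) • y, hay⟩
      refine ⟨b * a, ?_⟩
      have hb' : ((b : IwasawaAlgebra p) • ((a : IwasawaAlgebra p) • y)) = 0 := by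
        have h := congrArg Subtype.val hb
        simpa [Submonoid.smul_def] using h
      rw [Submonoid.smul_def, Submonoid.coe_mul, mul_smul]
      exact hb'
    refine ⟨hFY, hTY, fun φ hφ => ?_⟩
    -- characteristic ideals: both sides multiplicative, `N_n` multiplicative
    have hP₁ : Submodule.IsPrincipal (Module.charIdeal (IwasawaAlgebra p) N₁) :=
      charIdeal_isPrincipal_holds p N₁
    have hP₃ : Submodule.IsPrincipal (Module.charIdeal (IwasawaAlgebra p) N₃) :=
      charIdeal_isPrincipal_holds p N₃
    obtain ⟨f₁, hf₁⟩ := hP₁.principal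
    obtain ⟨f₃, hf₃⟩ := hP₃.principal
    have hf₁' : Module.charIdeal (IwasawaAlgebra p) N₁ = Ideal.span {f₁} := hf₁
    have hf₃' : Module.charIdeal (IwasawaAlgebra p) N₃ = Ideal.span {f₃} := hf₃
    have h2 : Module.charIdeal (IwasawaAlgebra p) N₂ = Ideal.span {f₁ * f₃} := by
      rw [Module.charIdeal_eq_mul_of_exact hN₂ f g hf hg hfg, hf₁', hf₃',
        Ideal.span_singleton_mul_span_singleton]
    have hY : Module.charIdeal (IwasawaAlgebra p) Y =
        Ideal.span {layerNorm p n f₁ * layerNorm p n f₃} := by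
      rw [Module.charIdeal_eq_mul_of_exact hTY Y₁.subtype Y₁.mkQ (Submodule.subtype_injective _)
        (Submodule.mkQ_surjective _) (LinearMap.exact_subtype_mkQ Y₁), hC₁ f₁ hf₁', hC₃ f₃ hf₃',
        Ideal.span_singleton_mul_span_singleton]
    rw [hY, ← map_mul]
    exact span_layerNorm_eq_of_span_eq (h2.symm.trans hφ)

/-! ## §5. The restriction theorem and its extension-of-scalars form -/

section Main

variable {X : Type v} [AddCommGroup X] [Module (IwasawaAlgebra p) X] [Module.Finite (IwasawaAlgebra p) X]
  {Y : Type w} [AddCommGroup Y] [Module (IwasawaAlgebra p) Y]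

/-- **A finitely generated `Λ`-module restricted to `Γ^{pⁿ}` is finitely generated** (over
`Λ_n ≅ Λ`; `Λ` is free of rank `pⁿ` over `Λ_n`). [cite: Washington1997, §13.2] -/
theorem moduleFinite_of_semilinear (hX : Module.IsTorsion (IwasawaAlgebra p) X)
    (ψ : Y →ₛₗ[layerHom p n] X) (hψ : Function.Bijective ψ) : Module.Finite (IwasawaAlgebra p) Y :=
  (finite_isTorsion_charIdeal_of_semilinear X hX Y ψ hψ).1

/-- **A finitely generated torsion `Λ`-module restricted to `Γ^{pⁿ}` is torsion.**
[cite: Washington1997, §13.2] -/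
theorem isTorsion_of_semilinear (hX : Module.IsTorsion (IwasawaAlgebra p) X)
    (ψ : Y →ₛₗ[layerHom p n] X) (hψ : Function.Bijective ψ) : Module.IsTorsion (IwasawaAlgebra p) Y :=
  (finite_isTorsion_charIdeal_of_semilinear X hX Y ψ hψ).2.1

/-- **B10 — `char_{Λ_n} = N_{Λ/Λ_n}(char_Λ)`.** Let `X` be a finitely generated torsion `Λ`-module
with `char_Λ X = (f)`, and `Y` any `Λ`-module with a bijective `layerHom p n`-semilinear map
`ψ : Y → X` (`ψ (a • y) = a(ω_n) • ψ y`: `Y` is `X` with only `Γ^{pⁿ} ⊂ Γ` acting, in the variable of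
`Λ_n = ℤ_p⟦ω_n⟧ ≅ Λ`). Then **`char_Λ Y = (N_n f)`**, `N_n = layerNorm p n` the norm of the free
rank-`pⁿ` extension `Λ ⊃ Λ_n`. [cite: Washington1997, §13.2] [cite: BourbakiAC5to7, Ch. VII §4 no. 5] -/
theorem charIdeal_eq_span_layerNorm_of_semilinear (hX : Module.IsTorsion (IwasawaAlgebra p) X)
    (ψ : Y →ₛₗ[layerHom p n] X) (hψ : Function.Bijective ψ) {f : IwasawaAlgebra p}
    (hf : Module.charIdeal (IwasawaAlgebra p) X = Ideal.span {f}) :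
    Module.charIdeal (IwasawaAlgebra p) Y = Ideal.span {layerNorm p n f} :=
  (finite_isTorsion_charIdeal_of_semilinear X hX Y ψ hψ).2.2 f hf

/-- `∃`-packaged form: there is a generator `f` of `char_Λ X` (the characteristic ideal of a
`Λ`-module is principal) and `char_Λ Y = (N_n f)`. [cite: Washington1997, §13.2] -/
theorem exists_charIdeal_eq_span_layerNorm_of_semilinear (hX : Module.IsTorsion (IwasawaAlgebra p) X)
    (ψ : Y →ₛₗ[layerHom p n] X) (hψ : Function.Bijective ψ) :
    ∃ f : IwasawaAlgebra p, Module.charIdeal (IwasawaAlgebra p) X = Ideal.span {f} ∧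
      Module.charIdeal (IwasawaAlgebra p) Y = Ideal.span {layerNorm p n f} := by
  have hP : Submodule.IsPrincipal (Module.charIdeal (IwasawaAlgebra p) X) :=
    charIdeal_isPrincipal_holds p X
  obtain ⟨f, hf⟩ := hP.principal
  exact ⟨f, hf, charIdeal_eq_span_layerNorm_of_semilinear hX ψ hψ hf⟩

/-- **Extension of scalars commutes with `layerHom`**: for any ring map `J : ℤ_p → 𝒪`,
`(g(ω_n)).map J = (g.map J)((1 + T)^{pⁿ} − 1)` in `𝒪⟦T⟧` (Mathlib `PowerSeries.map_subst`).
[folklore] -/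
theorem map_layerHom_eq_subst_map {𝒪 : Type*} [CommRing 𝒪] (J : ℤ_[p] →+* 𝒪) (g : IwasawaAlgebra p) :
    PowerSeries.map J (layerHom p n g) =
      (PowerSeries.map J g).subst ((1 + PowerSeries.X : PowerSeries 𝒪) ^ p ^ n - 1) := by
  rw [layerHom_apply]
  have h := PowerSeries.map_subst
    (Rank1Residual.Additive.hasSubst_one_add_X_pow_sub_one (R := ℤ_[p]) (p ^ n)) (h := J) g
  refine h.trans ?_
  congr 1
  change PowerSeries.map J ((1 + PowerSeries.X) ^ p ^ n - 1) = _
  rw [map_sub, map_pow, map_add, map_one, PowerSeries.map_X]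

/-- **B10 after extension of scalars** (the currency `char(X).map (PowerSeries.map J) = Ideal.span {·}`
of the tree's main-conjecture statements, e.g. `SelmerDualData.charIdeal`): with `X`, `Y`, `ψ`, `f`
as in `charIdeal_eq_span_layerNorm_of_semilinear` and any `J : ℤ_p → 𝒪`,
`(char_Λ Y) · 𝒪⟦S⟧ = ((N_n f).map J)`, and read back in the variable `T` of `Λ`,
`((N_n f).map J)((1+T)^{pⁿ} − 1) = (N_n f)(ω_n).map J`. [cite: Washington1997, §13.2] -/
theorem charIdeal_map_eq_span_of_semilinear (hX : Module.IsTorsion (IwasawaAlgebra p) X)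
    (ψ : Y →ₛₗ[layerHom p n] X) (hψ : Function.Bijective ψ) {f : IwasawaAlgebra p}
    (hf : Module.charIdeal (IwasawaAlgebra p) X = Ideal.span {f})
    {𝒪 : Type*} [CommRing 𝒪] (J : ℤ_[p] →+* 𝒪) :
    (Module.charIdeal (IwasawaAlgebra p) Y).map (PowerSeries.map J) =
        Ideal.span {PowerSeries.map J (layerNorm p n f)} ∧
      (PowerSeries.map J (layerNorm p n f)).subst ((1 + PowerSeries.X : PowerSeries 𝒪) ^ p ^ n - 1) =
        PowerSeries.map J (layerHom p n (layerNorm p n f)) := by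
  refine ⟨?_, (map_layerHom_eq_subst_map J _).symm⟩
  rw [charIdeal_eq_span_layerNorm_of_semilinear hX ψ hψ hf, Ideal.map_span, Set.image_singleton]

end Main

end Summit.BirchSwinnertonDyer.BirchSwinnertonDyer.Theorems.PrintCf2.LayerNormCharIdeal

end
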